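import Summits.KontsevichZagierPeriods.KontsevichZagierPeriods.Theorems.RootDecompZetaThreeFrontierWordRungTwoP10

/-! # `RootDecompZetaThreeFrontierWordRungTwoP11` — part 11/12 of the mechanical ≤270-line split of `RungTwo.stripped.lean`
(split by the decomp-kz census seat for landing; mathematics unchanged; part 11 continues part 10). -/

noncomputable section

namespace Summit.KontsevichZagierPeriods.RootDecompZetaThreeFrontier.WordLayer
open Set MeasureTheory MvPolynomial
open Literature.NumberTheory.Transcendental
open Summit.KontsevichZagierPeriods.KontsevichZagierPeriods.Theses.RootDecompZetaThreeFrontier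
  (HigherWeightDescent)
open Summit.KontsevichZagierPeriods.KontsevichZagierPeriods.Theses.LinRedNormalForm
  (DihedralNormalForm MzvKernelInKZ HoffmanSpanInKZ HoffmanIndependence)

section Necessity
open Literature.ModelTheory.ExponentialFields (IsSemialgebraic)

































/-! (private copy of `strictAnti_fin_one` — dedup.landed / split policy; origin part RootDecompZetaThreeFrontierWordRungTwoP1) -/
/-- Auxiliary step `strictAnti_fin_one`. [bookkeeping] -/
private theorem strictAnti_fin_one (y : Fin 1 → ℝ) : StrictAnti y := fun a b hab =>
  absurd hab (by rw [Subsingleton.elim a b]; exact lt_irrefl _)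

/-! (private copy of `mem_simplex_one_iff` — dedup.landed / split policy; origin part RootDecompZetaThreeFrontierWordRungTwoP1) -/
/-- Membership in `simplex_one_iff`, unfolded. [bookkeeping] -/
private theorem mem_simplex_one_iff (y : Fin 1 → ℝ) : y ∈ KZ.openOrderedSimplex 1 ↔ 0 < y 0 ∧ y 0 < 1 := by
  constructor
  · rintro ⟨h0, h1, -⟩
    exact ⟨h0 0, h1 0⟩
  · rintro ⟨h0, h1⟩
    refine ⟨fun i => ?_, fun i => ?_, strictAnti_fin_one y⟩
    · rw [Fin.fin_one_eq_zero i]; exact h0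
    · rw [Fin.fin_one_eq_zero i]; exact h1

/-! (private copy of `mem_simplex_two_iff` — dedup.landed / split policy; origin part RootDecompZetaThreeFrontierWordRungTwoP1) -/
/-- Membership in `simplex_two_iff`, unfolded. [bookkeeping] -/
private theorem mem_simplex_two_iff (z : Fin 2 → ℝ) :
    z ∈ KZ.openOrderedSimplex 2 ↔ 0 < z 1 ∧ z 1 < z 0 ∧ z 0 < 1 := by
  constructor
  · rintro ⟨h0, h1, ha⟩
    exact ⟨h0 1, ha (show (0 : Fin 2) < 1 by decide), h1 0⟩
  · rintro ⟨h1, h10, h0⟩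
    refine ⟨Fin.forall_fin_two.mpr ⟨h1.trans h10, h1⟩, Fin.forall_fin_two.mpr ⟨h0, h10.trans h0⟩,
      Fin.strictAnti_iff_succ_lt.mpr (Fin.forall_fin_one.mpr ?_)⟩
    simpa using h10

/-! (private copy of `measurableSet_simplex` — dedup.landed / split policy; origin part RootDecompZetaThreeFrontierWordRungTwoP4a) -/
/-- `simplex` is measurable. [bookkeeping] -/
private theorem measurableSet_simplex (k : ℕ) : MeasurableSet (KZ.openOrderedSimplex k) :=
  IsSemialgebraic.measurableSet_holds (KZ.isSemialgebraic_openOrderedSimplex k)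

/-! (private copy of `snoc_one_zero` — dedup.landed / split policy; origin part RootDecompZetaThreeFrontierWordRungTwoP4) -/
/-- Auxiliary step `snoc_one_zero`. [bookkeeping] -/
private theorem snoc_one_zero (x : Fin 1 → ℝ) (t : ℝ) : (Fin.snoc x t : Fin 2 → ℝ) 0 = x 0 := rfl

/-! (private copy of `snoc_one_one` — dedup.landed / split policy; origin part RootDecompZetaThreeFrontierWordRungTwoP4) -/
/-- Auxiliary step `snoc_one_one`. [bookkeeping] -/
private theorem snoc_one_one (x : Fin 1 → ℝ) (t : ℝ) : (Fin.snoc x t : Fin 2 → ℝ) 1 = t := rfl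

/-! (private copy of `snoc_section_two` — dedup.landed / split policy; origin part RootDecompZetaThreeFrontierWordRungTwoP4) -/
/-- Auxiliary step `snoc_section_two`. [bookkeeping] -/
private theorem snoc_section_two {x : Fin 1 → ℝ} (hx : x ∈ KZ.openOrderedSimplex 1) :
    {t : ℝ | (Fin.snoc x t : Fin 2 → ℝ) ∈ KZ.openOrderedSimplex 2} = Ioo 0 (x 0) := by
  obtain ⟨hx0, hx1⟩ := (mem_simplex_one_iff x).1 hx
  ext t
  rw [mem_setOf_eq, mem_simplex_two_iff, snoc_one_zero, snoc_one_one, mem_Ioo]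
  exact ⟨fun h => ⟨h.1, h.2.1⟩, fun h => ⟨h.1, h.2, hx1⟩⟩

/-- **CORNER ORDERS FORCED BY INTEGRABILITY.**  If `P/(t₀^β(1-t₁)^γ)` is integrable on `Δ₂` then every monomial of `P` has
degree `≥ β - 1` and every monomial of `P(1-s₀,1-s₁)` has degree `≥ γ - 1`.  (Blow up the corner: under `Ψ(s,t) = (t,ts)` the
integrand times the Jacobian `t` is `P^↑(s,t)/(t^β (1-ts)^γ)` on the square, `P^↑ = cornerLift 1 P`, and the face lemma at `t = 0`
applies; the corner `(1,1)` is the corner `(0,0)` of `σ`.) -/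
theorem corner_orders (P : MvPolynomial (Fin 2) ℚ) (β γ : ℕ)
    (hint : IntegrableOn (fun t => MvPolynomial.aeval t P / (t 0 ^ β * (1 - t 1) ^ γ)) (KZ.openOrderedSimplex 2)) :
    (∀ e ∈ P.support, β ≤ e 0 + e 1 + 1) ∧ (∀ s ∈ (flipXY P).support, γ ≤ s 0 + s 1 + 1) := by
  have hSq1 : ∀ y ∈ Sq, y 1 ≠ 0 := fun y hy => hy.2.2.1.ne'
  have hsec : ∀ x ∈ KZ.openOrderedSimplex 1,
      {t : ℝ | (Fin.snoc x t : Fin 2 → ℝ) ∈ Sq} = Ioo 0 ((fun _ : Fin 1 → ℝ => (1 : ℝ)) x) :=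
    fun x hx => snoc_section_Sq hx
  have hℓ : ∀ x ∈ KZ.openOrderedSimplex 1,
      0 < (fun _ : Fin 1 → ℝ => (1 : ℝ)) x ∧ (fun _ : Fin 1 → ℝ => (1 : ℝ)) x ≤ 1 :=
    fun _ _ => ⟨one_pos, le_rfl⟩
  have hDc : ∀ (n : ℕ), ∀ x ∈ KZ.openOrderedSimplex 1,
      ContinuousAt (fun s : ℝ => (fun y : Fin 2 → ℝ => (1 - y 1 * y 0) ^ n) (Fin.snoc x s)) 0 := by
    intro n x _
    show ContinuousAt (fun s : ℝ => (1 - s * x 0) ^ n) 0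
    exact (by fun_prop : Continuous fun s : ℝ => (1 - s * x 0) ^ n).continuousAt
  have hD0 : ∀ (n : ℕ), ∀ x ∈ KZ.openOrderedSimplex 1,
      (fun y : Fin 2 → ℝ => (1 - y 1 * y 0) ^ n) (Fin.snoc x (0 : ℝ)) ≠ 0 := by
    intro n x _
    show ((1 : ℝ) - 0 * x 0) ^ n ≠ 0
    simp
  constructor
  · -- the corner `(0,0)`
    have h1 := integrableOn_chart hint
    have h2 : IntegrableOn (fun y => MvPolynomial.aeval y (cornerLift 1 P) /
        (y 1 ^ β * (fun y : Fin 2 → ℝ => (1 - y 1 * y 0) ^ γ) y)) Sq := by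
      refine h1.congr_fun (fun y hy => ?_) measurableSet_Sq
      show y 1 * (MvPolynomial.aeval (chΨ y) P / (chΨ y 0 ^ β * (1 - chΨ y 1) ^ γ)) =
        MvPolynomial.aeval y (cornerLift 1 P) / (y 1 ^ β * (1 - y 1 * y 0) ^ γ)
      rw [aeval_eq_sum_std P (chΨ y), aeval_cornerLift, ← mul_div_assoc]
      simp only [chΨ_zero, chΨ_one]
      congr 1
      rw [Finset.mul_sum]
      exact Finset.sum_congr rfl fun e _ => by ring
    intro e he
    have := face_lemma measurableSet_Sq hSq1 _ hsec hℓ _ (hDc γ) (hD0 γ) β (cornerLift 1 P) h2 _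
      (mem_support_cornerLift 1 P he)
    simpa [Finsupp.single_apply] using this
  · -- the corner `(1,1)` = the corner `(0,0)` of the dual
    have h1 := integrableOn_chart (integrableOn_comp_spΦ hint)
    have h2 : IntegrableOn (fun y => MvPolynomial.aeval y (cornerLift 0 (flipXY P)) /
        (y 1 ^ γ * (fun y : Fin 2 → ℝ => (1 - y 1 * y 0) ^ β) y)) Sq := by
      refine h1.congr_fun (fun y hy => ?_) measurableSet_Sq
      show y 1 * (MvPolynomial.aeval (spΦ (chΨ y)) P / (spΦ (chΨ y) 0 ^ β * (1 - spΦ (chΨ y) 1) ^ γ)) =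
        MvPolynomial.aeval y (cornerLift 0 (flipXY P)) / (y 1 ^ γ * (1 - y 1 * y 0) ^ β)
      have e1 : (fun i => MvPolynomial.aeval ![y 1 * y 0, y 1]
          ((![MvPolynomial.C 1 - MvPolynomial.X 0, MvPolynomial.C 1 - MvPolynomial.X 1] :
            Fin 2 → MvPolynomial (Fin 2) ℚ) i)) = spΦ (chΨ y) := by
        funext i
        fin_cases i <;> simp [spΦ_zero, spΦ_one, chΨ_zero, chΨ_one]
      have key : MvPolynomial.aeval (spΦ (chΨ y)) P = MvPolynomial.aeval ![y 1 * y 0, y 1] (flipXY P) := by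
        rw [flipXY, MvPolynomial.aeval_bind₁, e1]
      rw [key, aeval_eq_sum_std (flipXY P) ![y 1 * y 0, y 1], spΦ_zero, spΦ_one, chΨ_zero, chΨ_one, sub_sub_cancel,
        aeval_cornerLift,
        ← mul_div_assoc, mul_comm ((1 - y 1 * y 0) ^ β)]
      congr 1
      rw [Finset.mul_sum]
      refine Finset.sum_congr rfl fun e _ => ?_
      simp only [Matrix.cons_val_zero, Matrix.cons_val_one]
      ring
    intro s hs
    have := face_lemma measurableSet_Sq hSq1 _ hsec hℓ _ (hDc β) (hD0 β) γ (cornerLift 0 (flipXY P)) h2 _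
      (mem_support_cornerLift 0 (flipXY P) hs)
    simpa [Finsupp.single_apply] using this

/-! ### 21e  Face cancellation and the rung `K = 2` in full -/

/-- the genus-zero integrand of dimension `2`: `P/(t₀^{b₀} t₁^{b₁} (1-t₀)^{c₀} (1-t₁)^{c₁} (t₀-t₁)^{a})` -/
def gzf (p : MvPolynomial (Fin 2) ℚ) (b₀ b₁ c₀ c₁ a : ℕ) (t : Fin 2 → ℝ) : ℝ :=
  MvPolynomial.aeval t p / (t 0 ^ b₀ * t 1 ^ b₁ * (1 - t 0) ^ c₀ * (1 - t 1) ^ c₁ * (t 0 - t 1) ^ a)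

/-- Auxiliary step `gz_denoms_pos`. [bookkeeping] -/
theorem gz_denoms_pos {t : Fin 2 → ℝ} (ht : t ∈ KZ.openOrderedSimplex 2) :
    0 < t 0 ∧ 0 < t 1 ∧ 0 < 1 - t 0 ∧ 0 < 1 - t 1 ∧ 0 < t 0 - t 1 := by
  obtain ⟨h1, h10, h0⟩ := (mem_simplex_two_iff t).1 ht
  exact ⟨h1.trans h10, h1, by linarith, by linarith, by linarith⟩

/-- `P ↦ P(t₀, t₀ - t₁)` (the shear on polynomials; an involution) -/
def shP : MvPolynomial (Fin 2) ℚ →ₐ[ℚ] MvPolynomial (Fin 2) ℚ :=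
  MvPolynomial.bind₁ ![MvPolynomial.X 0, MvPolynomial.X 0 - MvPolynomial.X 1]

/-- Auxiliary step `shP_shP`. [bookkeeping] -/
theorem shP_shP (p : MvPolynomial (Fin 2) ℚ) : shP (shP p) = p := by
  have h : shP.comp shP = AlgHom.id ℚ _ := MvPolynomial.algHom_ext fun i => by
    fin_cases i <;> simp [shP, MvPolynomial.bind₁_X_right]
  exact AlgHom.congr_fun h p

/-- Auxiliary step `aeval_shP`. [bookkeeping] -/
theorem aeval_shP (p : MvPolynomial (Fin 2) ℚ) (t : Fin 2 → ℝ) :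
    MvPolynomial.aeval t (shP p) = MvPolynomial.aeval (shΦ t) p := by
  have e : (fun i => MvPolynomial.aeval t
      ((![MvPolynomial.X 0, MvPolynomial.X 0 - MvPolynomial.X 1] : Fin 2 → MvPolynomial (Fin 2) ℚ) i)) = shΦ t := by
    funext i
    fin_cases i <;> simp [shΦ_zero, shΦ_one]
  rw [shP, MvPolynomial.aeval_bind₁, e]

/-- `P ↦ P(1 - t₁, 1 - t₀)` (the duality on polynomials; an involution) -/
def duP : MvPolynomial (Fin 2) ℚ →ₐ[ℚ] MvPolynomial (Fin 2) ℚ :=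
  MvPolynomial.bind₁ ![MvPolynomial.C 1 - MvPolynomial.X 1, MvPolynomial.C 1 - MvPolynomial.X 0]

/-- Auxiliary step `duP_duP`. [bookkeeping] -/
theorem duP_duP (p : MvPolynomial (Fin 2) ℚ) : duP (duP p) = p := by
  have h : duP.comp duP = AlgHom.id ℚ _ := MvPolynomial.algHom_ext fun i => by
    fin_cases i <;> simp [duP, MvPolynomial.bind₁_X_right]
  exact AlgHom.congr_fun h p

/-- Auxiliary step `aeval_duP`. [bookkeeping] -/
theorem aeval_duP (p : MvPolynomial (Fin 2) ℚ) (t : Fin 2 → ℝ) :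
    MvPolynomial.aeval t (duP p) = MvPolynomial.aeval (spΦ t) p := by
  have e : (fun i => MvPolynomial.aeval t
      ((![MvPolynomial.C 1 - MvPolynomial.X 1, MvPolynomial.C 1 - MvPolynomial.X 0] :
        Fin 2 → MvPolynomial (Fin 2) ℚ) i)) = spΦ t := by
    funext i
    fin_cases i <;> simp [spΦ_zero, spΦ_one]
  rw [duP, MvPolynomial.aeval_bind₁, e]

/-- **face `t₁ = 0`**: integrability forces `t₁^{b₁} ∣ P` -/
theorem face_t1 (p : MvPolynomial (Fin 2) ℚ) (b₀ b₁ c₀ c₁ a : ℕ)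
    (hint : IntegrableOn (gzf p b₀ b₁ c₀ c₁ a) (KZ.openOrderedSimplex 2)) :
    ∃ p₁ : MvPolynomial (Fin 2) ℚ, EqOn (gzf p b₀ b₁ c₀ c₁ a) (gzf p₁ b₀ 0 c₀ c₁ a) (KZ.openOrderedSimplex 2) := by
  have hsupp : ∀ e ∈ p.support, b₁ ≤ e 1 := by
    refine face_lemma (measurableSet_simplex 2) (fun y hy => (gz_denoms_pos hy).2.1.ne') (fun x => x 0)
      (fun x hx => snoc_section_two hx)
      (fun x hx => ⟨((mem_simplex_one_iff x).1 hx).1, ((mem_simplex_one_iff x).1 hx).2.le⟩)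
      (fun t => t 0 ^ b₀ * (1 - t 0) ^ c₀ * (1 - t 1) ^ c₁ * (t 0 - t 1) ^ a) (fun x _ => ?_) (fun x hx => ?_) b₁ p
      (hint.congr_fun (fun t ht => ?_) (measurableSet_simplex 2))
    · show ContinuousAt (fun s : ℝ => x 0 ^ b₀ * (1 - x 0) ^ c₀ * (1 - s) ^ c₁ * (x 0 - s) ^ a) 0
      exact (by fun_prop : Continuous fun s : ℝ => x 0 ^ b₀ * (1 - x 0) ^ c₀ * (1 - s) ^ c₁ * (x 0 - s) ^ a).continuousAt
    · obtain ⟨hx0, hx1⟩ := (mem_simplex_one_iff x).1 hx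
      show x 0 ^ b₀ * (1 - x 0) ^ c₀ * (1 - 0) ^ c₁ * (x 0 - 0) ^ a ≠ 0
      have : 0 < 1 - x 0 := by linarith
      rw [sub_zero, sub_zero]
      positivity
    · obtain ⟨h0, h1, h2, h3, h4⟩ := gz_denoms_pos ht
      show gzf p b₀ b₁ c₀ c₁ a t =
        MvPolynomial.aeval t p / (t 1 ^ b₁ * (t 0 ^ b₀ * (1 - t 0) ^ c₀ * (1 - t 1) ^ c₁ * (t 0 - t 1) ^ a))
      rw [gzf, div_eq_div_iff (by positivity) (by positivity)]
      ring
  obtain ⟨p₁, rfl⟩ := exists_X_pow_mul 1 b₁ p hsupp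
  refine ⟨p₁, fun t ht => ?_⟩
  obtain ⟨h0, h1, h2, h3, h4⟩ := gz_denoms_pos ht
  simp only [gzf, map_mul, map_pow, MvPolynomial.aeval_X, pow_zero, mul_one]
  rw [div_eq_div_iff (by positivity) (by positivity)]
  ring

/-- **face `t₁ = t₀`**: integrability forces `(t₀-t₁)^{a} ∣ P` (shear `τ` to the face `t₁ = 0`) -/
theorem face_diag (p : MvPolynomial (Fin 2) ℚ) (b₀ c₀ c₁ a : ℕ)
    (hint : IntegrableOn (gzf p b₀ 0 c₀ c₁ a) (KZ.openOrderedSimplex 2)) :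
    ∃ p₂ : MvPolynomial (Fin 2) ℚ, EqOn (gzf p b₀ 0 c₀ c₁ a) (gzf p₂ b₀ 0 c₀ c₁ 0) (KZ.openOrderedSimplex 2) := by
  have hsupp : ∀ e ∈ (shP p).support, a ≤ e 1 := by
    refine face_lemma (measurableSet_simplex 2) (fun y hy => (gz_denoms_pos hy).2.1.ne') (fun x => x 0)
      (fun x hx => snoc_section_two hx)
      (fun x hx => ⟨((mem_simplex_one_iff x).1 hx).1, ((mem_simplex_one_iff x).1 hx).2.le⟩)
      (fun u => u 0 ^ b₀ * (1 - u 0) ^ c₀ * (1 - u 0 + u 1) ^ c₁) (fun x _ => ?_) (fun x hx => ?_) a (shP p)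
      ((integrableOn_comp_shΦ hint).congr_fun (fun u hu => ?_) (measurableSet_simplex 2))
    · show ContinuousAt (fun s : ℝ => x 0 ^ b₀ * (1 - x 0) ^ c₀ * (1 - x 0 + s) ^ c₁) 0
      exact (by fun_prop : Continuous fun s : ℝ => x 0 ^ b₀ * (1 - x 0) ^ c₀ * (1 - x 0 + s) ^ c₁).continuousAt
    · obtain ⟨hx0, hx1⟩ := (mem_simplex_one_iff x).1 hx
      show x 0 ^ b₀ * (1 - x 0) ^ c₀ * (1 - x 0 + 0) ^ c₁ ≠ 0
      have : 0 < 1 - x 0 := by linarith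
      rw [add_zero]
      positivity
    · obtain ⟨h0, h1, h2, h3, h4⟩ := gz_denoms_pos hu
      have h5 : 0 < 1 - u 0 + u 1 := by linarith
      show gzf p b₀ 0 c₀ c₁ a (shΦ u) =
        MvPolynomial.aeval u (shP p) / (u 1 ^ a * (u 0 ^ b₀ * (1 - u 0) ^ c₀ * (1 - u 0 + u 1) ^ c₁))
      rw [aeval_shP, gzf, shΦ_zero, shΦ_one, sub_sub_cancel, show (1 : ℝ) - (u 0 - u 1) = 1 - u 0 + u 1 by ring,
        pow_zero, mul_one, div_eq_div_iff (by positivity) (by positivity)]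
      ring
  obtain ⟨q, hq⟩ := exists_X_pow_mul 1 a (shP p) hsupp
  have hp : p = (MvPolynomial.X 0 - MvPolynomial.X 1) ^ a * shP q := by
    rw [← shP_shP p, hq, map_mul, map_pow]
    congr 2
    simp [shP, MvPolynomial.bind₁_X_right]
  refine ⟨shP q, fun t ht => ?_⟩
  obtain ⟨h0, h1, h2, h3, h4⟩ := gz_denoms_pos ht
  rw [hp]
  simp only [gzf, map_mul, map_pow, map_sub, MvPolynomial.aeval_X, pow_zero, mul_one]
  rw [div_eq_div_iff (by positivity) (by positivity)]
  ring

/-- **face `t₀ = 1`**: integrability forces `(1-t₀)^{c₀} ∣ P` (duality `σ` to the face `t₁ = 0`) -/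
theorem face_t0 (p : MvPolynomial (Fin 2) ℚ) (b₀ c₀ c₁ : ℕ)
    (hint : IntegrableOn (gzf p b₀ 0 c₀ c₁ 0) (KZ.openOrderedSimplex 2)) :
    ∃ p₃ : MvPolynomial (Fin 2) ℚ, EqOn (gzf p b₀ 0 c₀ c₁ 0) (gzf p₃ b₀ 0 0 c₁ 0) (KZ.openOrderedSimplex 2) := by
  have hsupp : ∀ e ∈ (duP p).support, c₀ ≤ e 1 := by
    refine face_lemma (measurableSet_simplex 2) (fun y hy => (gz_denoms_pos hy).2.1.ne') (fun x => x 0)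
      (fun x hx => snoc_section_two hx)
      (fun x hx => ⟨((mem_simplex_one_iff x).1 hx).1, ((mem_simplex_one_iff x).1 hx).2.le⟩)
      (fun w => (1 - w 1) ^ b₀ * w 0 ^ c₁) (fun x _ => ?_) (fun x hx => ?_) c₀ (duP p)
      ((integrableOn_comp_spΦ hint).congr_fun (fun w hw => ?_) (measurableSet_simplex 2))
    · show ContinuousAt (fun s : ℝ => (1 - s) ^ b₀ * x 0 ^ c₁) 0
      exact (by fun_prop : Continuous fun s : ℝ => (1 - s) ^ b₀ * x 0 ^ c₁).continuousAt
    · obtain ⟨hx0, hx1⟩ := (mem_simplex_one_iff x).1 hx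
      show ((1 : ℝ) - 0) ^ b₀ * x 0 ^ c₁ ≠ 0
      rw [sub_zero]
      positivity
    · obtain ⟨h0, h1, h2, h3, h4⟩ := gz_denoms_pos hw
      show gzf p b₀ 0 c₀ c₁ 0 (spΦ w) = MvPolynomial.aeval w (duP p) / (w 1 ^ c₀ * ((1 - w 1) ^ b₀ * w 0 ^ c₁))
      rw [aeval_duP, gzf, spΦ_zero, spΦ_one, sub_sub_cancel, sub_sub_cancel, pow_zero, pow_zero, mul_one, mul_one,
        div_eq_div_iff (by positivity) (by positivity)]
      ring
  obtain ⟨q, hq⟩ := exists_X_pow_mul 1 c₀ (duP p) hsupp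
  have hp : p = (MvPolynomial.C 1 - MvPolynomial.X 0) ^ c₀ * duP q := by
    rw [← duP_duP p, hq, map_mul, map_pow]
    congr 2
    simp [duP, MvPolynomial.bind₁_X_right]
  refine ⟨duP q, fun t ht => ?_⟩
  obtain ⟨h0, h1, h2, h3, h4⟩ := gz_denoms_pos ht
  rw [hp]
  simp only [gzf, map_mul, map_pow, map_sub, MvPolynomial.aeval_X, map_one, pow_zero, mul_one]
  rw [div_eq_div_iff (by positivity) (by positivity)]
  ring

end Necessity
end Summit.KontsevichZagierPeriods.RootDecompZetaThreeFrontier.WordLayer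
end
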